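import Literature.AnabelianGeometry.SemiGraphs.TemperedCurveGroupLevelDataNonVacuity2
import HarnessLib

/-!
# Killing one free generator of `F̂₂`: the kernel of the completed exponent sum in `b` is the CLOSED
# NORMAL SUBGROUP GENERATED BY `η(a)` (abc-iut-w5-d197, gen 2; tool extracted from p429179)

For the profinite completion `F̂₂` of the free group on `a, b` (`η : F₂ → F̂₂`), the completed exponent
sum `ê_b : F̂₂ → Ẑ` in `b` (the continuous extension of `σ_b : F₂ → ℤ`) and any continuous `î_b : Ẑ → F̂₂`
completing `k ↦ b^k`:  `Ker ê_b` is the topological closure of the normal closure of `{η a}` — i.e.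
"`F̂₂ / ⟨⟨a⟩⟩^closure = Ẑ`, generated by the image of `b`".  This is the kernel clause of [AbsTopI] Def 4.2
(iii)(c) (de-cuspidalization: "kernel topologically normally generated by the inertia group of a cusp")
at the free profinite model, proved inline in `AbsTopIProp410DeCuspidalizationNonVacuity.lean`
(p429179) with an extra direct factor `G_{ℚ_p}`; recorded here over `F̂₂` ALONE as a reusable lemma for
quotient constructions (DLoc objects, further de-cuspidalizations).  PROOF: "⊇" — `ê_b (η a) = ι(σ_b a) = 1`
and kernels are closed normal; "⊆" — in the Hausdorff quotient `Q := F̂₂ / N` the continuous map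
`y ↦ [î_b (ê_b y)]` agrees with the projection on the dense subgroup `η(F₂)`: for `u ∈ F₂` with
`σ_b(u) = k`, `b^{-k} u ∈ ⟨⟨a⟩⟩ ≤ F₂` because `F₂ / ⟨⟨a⟩⟩` is generated by the class of `b`
(`FreeGroup.ext_hom`), hence everywhere (`DenseRange.equalizer`); at `y ∈ Ker ê_b` this reads `[y] = 1`.
Pure group theory/topology (Mathlib + the cell's `F̂₂` toolkit of abc-iut-w5-d218); nothing here bears on
[IUTchIII] Cor 3.12; typed ≠ proved.
-/

namespace Literature.AnabelianGeometry.SemiGraphs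

open _root_.Topology _root_.Filter _root_.Set _root_.Function
open Literature.IUT.HodgeTheaters (profiniteCompletion toCompletion toCompletion_int_injective)

namespace TemperedFibreProduct

/-- **`Ker(ê_b) = ⟨⟨η a⟩⟩^closure` in `F̂₂`** (killing the free generator `a` leaves the procyclic group
generated by `b`): for `ê_b` completing the exponent sum `σ_b` in the second generator and `î_b`
completing `k ↦ b^k`, the kernel of `ê_b` is the topological closure of the normal closure of `{η a}`.
[cite: MochizukiAbsTopI2012, Def 4.2 (iii) p.50] -/
theorem ker_eq_closure_normalClosure_of_expSum
    (êb : profiniteCompletion (FreeGroup (Fin 2)) →ₜ* profiniteCompletion (Multiplicative ℤ))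
    (îb : profiniteCompletion (Multiplicative ℤ) →ₜ* profiniteCompletion (FreeGroup (Fin 2)))
    (hêb : ∀ g, êb (toCompletion _ g) = toCompletion _
      ((FreeGroup.lift fun j : Fin 2 => if j = 1 then Multiplicative.ofAdd (1 : ℤ) else 1) g))
    (hîb : ∀ k : ℤ, îb (toCompletion _ (Multiplicative.ofAdd k)) =
      toCompletion _ (FreeGroup.of (1 : Fin 2) ^ k)) :
    êb.toMonoidHom.ker =
      (Subgroup.normalClosure
        ({toCompletion (FreeGroup (Fin 2)) (FreeGroup.of 0)} :
          Set (profiniteCompletion (FreeGroup (Fin 2))))).topologicalClosure := by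
  classical
  let P : ProfiniteGrp.{0} := profiniteCompletion (FreeGroup (Fin 2))
  let Zh : ProfiniteGrp.{0} := profiniteCompletion (Multiplicative ℤ)
  let η : FreeGroup (Fin 2) →* P := toCompletion (FreeGroup (Fin 2))
  let ι : Multiplicative ℤ →* Zh := toCompletion (Multiplicative ℤ)
  let a : FreeGroup (Fin 2) := FreeGroup.of 0
  let b : FreeGroup (Fin 2) := FreeGroup.of 1
  let σb : FreeGroup (Fin 2) →* Multiplicative ℤ :=
    FreeGroup.lift fun j => if j = (1 : Fin 2) then Multiplicative.ofAdd (1 : ℤ) else 1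
  have hσba : σb a = 1 := by simp [σb, a]
  have hσbb : σb b = Multiplicative.ofAdd 1 := by simp [σb, b]
  have hêb' : ∀ g, êb (η g) = ι (σb g) := hêb
  have hêbîb : ∀ t, êb (îb t) = t := TemperedFibreProduct.apply_apply_eq_self_of b σb hσbb êb îb hêb' hîb
  change êb.toMonoidHom.ker = (Subgroup.normalClosure ({η a} : Set P)).topologicalClosure
  set N : Subgroup P := (Subgroup.normalClosure ({η a} : Set P)).topologicalClosure with hN
  haveI hNn : N.Normal := Subgroup.is_normal_topologicalClosure _
  have hNclosed : IsClosed (N : Set P) := Subgroup.isClosed_topologicalClosure _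
  have haN : η a ∈ N :=
    Subgroup.le_topologicalClosure _ (Subgroup.subset_normalClosure (Set.mem_singleton _))
  apply le_antisymm
  · -- `Ker ≤ N`
    haveI : IsClosed (N : Set P) := hNclosed
    -- `σ_b v = 0 ⇒ η v ∈ N`
    have hvN : ∀ v : FreeGroup (Fin 2), σb v = 1 → η v ∈ N := by
      intro v hv
      let Ncl : Subgroup (FreeGroup (Fin 2)) := Subgroup.normalClosure ({a} : Set (FreeGroup (Fin 2)))
      have hqa : (QuotientGroup.mk' Ncl) a = 1 :=
        (QuotientGroup.eq_one_iff a).mpr (Subgroup.subset_normalClosure (Set.mem_singleton a))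
      have hhom : QuotientGroup.mk' Ncl =
          ((zpowersHom (FreeGroup (Fin 2) ⧸ Ncl) (QuotientGroup.mk' Ncl b) :
            Multiplicative ℤ →* FreeGroup (Fin 2) ⧸ Ncl)).comp σb := by
        refine FreeGroup.ext_hom _ _ fun i => ?_
        match i with
        | 0 =>
          change (QuotientGroup.mk' Ncl) a = _
          rw [hqa, MonoidHom.comp_apply, zpowersHom_apply]
          change (1 : FreeGroup (Fin 2) ⧸ Ncl) = _ ^ (Multiplicative.toAdd (σb a))
          rw [hσba]; simp
        | 1 =>
          change (QuotientGroup.mk' Ncl) b = _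
          rw [MonoidHom.comp_apply, zpowersHom_apply]
          change _ = _ ^ (Multiplicative.toAdd (σb b))
          rw [hσbb]; simp
      have hqv : (QuotientGroup.mk' Ncl) v = 1 := by
        rw [hhom, MonoidHom.comp_apply, zpowersHom_apply, hv]
        simp
      have hvmem : v ∈ Ncl := (QuotientGroup.eq_one_iff v).mp hqv
      have hle : Ncl ≤ N.comap η := by
        refine Subgroup.normalClosure_le_normal ?_
        intro w hw
        rw [Set.mem_singleton_iff] at hw
        subst hw
        exact haN
      exact hle hvmem
    -- the projection and the retraction-composite agree on the dense `η(F₂)`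
    let π : P → P ⧸ N := QuotientGroup.mk
    let ρ : P → P ⧸ N := fun y => π (îb (êb y))
    have hπ : Continuous π := QuotientGroup.continuous_mk
    have hρ : Continuous ρ := hπ.comp (îb.continuous.comp êb.continuous)
    have hdense : DenseRange η := ProfiniteGrp.ProfiniteCompletion.denseRange (GrpCat.of (FreeGroup (Fin 2)))
    have hagree : ρ ∘ η = π ∘ η := by
      funext u
      change π (îb (êb (η u))) = π (η u)
      have hk : êb (η u) = ι (Multiplicative.ofAdd (Multiplicative.toAdd (σb u))) := by
        rw [hêb']; rfl
      rw [hk, hîb]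
      refine QuotientGroup.eq.mpr ?_
      have hprod : (η (b ^ Multiplicative.toAdd (σb u)))⁻¹ * η u =
          η ((b ^ Multiplicative.toAdd (σb u))⁻¹ * u) := by
        rw [map_mul, map_inv]
      rw [hprod]
      refine hvN _ ?_
      rw [map_mul, map_inv, map_zpow, hσbb, ← ofAdd_zsmul, smul_eq_mul, mul_one, ofAdd_toAdd,
        inv_mul_cancel]
    have hρπ : ρ = π := hdense.equalizer hρ hπ hagree
    intro y hy
    have hy1 : êb y = 1 := (MonoidHom.mem_ker).1 hy
    have hπy : π y = 1 := by
      rw [← congrFun hρπ y]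
      change π (îb (êb y)) = 1
      rw [hy1, map_one]
      rfl
    exact (QuotientGroup.eq_one_iff y).mp hπy
  · -- `N ≤ Ker`
    refine Subgroup.topologicalClosure_minimal _ (Subgroup.normalClosure_le_normal ?_) ?_
    · intro y hy
      rw [Set.mem_singleton_iff] at hy
      subst hy
      rw [SetLike.mem_coe, MonoidHom.mem_ker]
      change êb (η a) = 1
      rw [hêb', hσba, map_one]
    · have : ((êb.toMonoidHom.ker : Subgroup P) : Set P) = êb ⁻¹' {1} := by
        ext y; simp [MonoidHom.mem_ker]
      rw [this]
      exact isClosed_singleton.preimage êb.continuous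

/-- The same, with `ê_b`, `î_b` taken to be THE canonical completions
(`ProfiniteCompletion.lift` of `ι ∘ σ_b` and of `η ∘ (k ↦ b^k)`), so that no hypothesis remains.
[cite: MochizukiAbsTopI2012, Def 4.2 (iii) p.50] -/
theorem ker_liftExpSum_eq_closure_normalClosure :
    (ProfiniteGrp.ProfiniteCompletion.lift (GrpCat.ofHom
        ((toCompletion (Multiplicative ℤ)).comp
          (FreeGroup.lift fun j : Fin 2 => if j = 1 then Multiplicative.ofAdd (1 : ℤ) else 1)))).hom.toMonoidHom.ker =
      (Subgroup.normalClosure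
        ({toCompletion (FreeGroup (Fin 2)) (FreeGroup.of 0)} :
          Set (profiniteCompletion (FreeGroup (Fin 2))))).topologicalClosure := by
  refine ker_eq_closure_normalClosure_of_expSum _
    (ProfiniteGrp.ProfiniteCompletion.lift (GrpCat.ofHom
      ((toCompletion (FreeGroup (Fin 2))).comp (zpowersHom _ (FreeGroup.of (1 : Fin 2)))))).hom
    (fun g => lift_hom_toCompletion _ _ g) (fun k => ?_)
  rw [lift_hom_toCompletion _ ((toCompletion (FreeGroup (Fin 2))).comp (zpowersHom _ (FreeGroup.of 1)))]
  simp [zpowersHom_apply]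

end TemperedFibreProduct

end Literature.AnabelianGeometry.SemiGraphs
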